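import Summits.BirchSwinnertonDyer.Rank1Residual.Supersingular.X7Visibility5L1CertLocRecords07
import Summits.BirchSwinnertonDyer.Rank1Residual.Supersingular.LocalOddTorsionAdicCompletionAt
import HarnessLib

/-!
# X7 (N5) rank-0 VISIBILITY offers with EVERY LOCAL BINDER DISCHARGED — final-layer twins of `X7Visibility5Records07.lean` (`422370du1`@`7`)
# (base = the landed twin(s) `X7Visibility5L1CertLocRecords07.lean`; minus the kind-(i)/paid `#F(ℚ_w)[p] = 1`, kind-(ii) `#E(ℚ_v)[5] ≤ 5` and kind-(iv) `#F(ℚ_w)[5] = 5 ^ 1` binders, PROVED IN PLACE by the kernel decider (the same statements and certificates as the record files `X7VisibilityLocalTorsionRecords02.lean`))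

Cell `b2b-bsdres`, supersingular family, prover A = unit `b2b-bsdres-x10b` (gen 24; generator `HOME/b2b-bsdres-x10b/gen24/code/final/gen_visfinal.py`).
THEOREMS ONLY (1 twin(s), 4 local binders discharged): each theorem is the landed base twin with its local torsion binders
`(hℓ : ∀ w, (primesEquiv w : ℕ) = ℓ → Nat.card (nsmulAddMonoidHom p : (F.baseChange (w.adicCompletion ℚ)).toAffine.Point →+ _).ker = 1)`
(the `p`-congruent visibility partner `F` has no `ℚ_w`-rational `p`-torsion at the bad / paid places — Cremona–Mazur's local conditions,
Wuthrich Prop. 21) and, on the five `5Nn` targets, `(hℓ : ∀ w, … → Nat.card (… (W.baseChange …) …).ker ≤ 5)` at the split multiplicative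
place `ℓ ≡ 1 (mod 5)` and, on the four `324032u1` / `139536q1` rows, the kind-(iv) numeral `(hℓ : ∀ w, … → Nat.card (… (F.baseChange …) …).ker = 5 ^ 1)`
at the partner's split multiplicative place `67` / `53`, REPLACED by the record theorems `natCard_ker_five_partner_<label>_at<ℓ> hFeq` /
`natCard_ker_seven_partner_…` / `natCard_ker_five_target_<label>_at<ℓ>_le hWeq` / `natCard_ker_five_partner_<label>_at<ℓ>_eq hFeq` — KERNEL theorems: the odd-prime local torsion DECIDER
`Supersingular/LocalOddTorsionDeciderAt.lean` (`#E(ℚ_ℓ)[n] = 1 + 2S`: abscissae of `n`-torsion points are `ℓ`-adic integers, `nP = O ⟺ ψₙ(x) = 0`,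
Hensel root census `PadicRootCensusNewton.check₄` of the exact integer `ψ₅` / `ψ₇`, fibres by the square class of `4x³ + b₂x² + 2b₄x + b₆`),
the bridge `LocalOddTorsionAdicCompletionAt.lean` (`ℚ_[ℓ] ≃ w.adicCompletion ℚ`), certificates found by `gen23/code/oddtors_cert.py` and
CHECKED by `decide +kernel` (`S = 0` at the kind-(i)/paid places; `S = 2`, i.e. count `5` exactly, at the five kind-(ii) targets and the two kind-(iv) partners).  Proof of each twin = one `have` per local binder (the record theorem, statement and certificate VERBATIM, proved IN PLACE from the bridge `LocalOddTorsionAdicCompletionAt` so that this file waits for no record olean) + ONE `exact` on the base twin.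
After this layer the binders of a rank-0 visibility offer are EXACTLY: the named facts of the source (+ `hF13` / `hF44` / `hMR` where displayed),
the period comparison `hϖ`, the newform `f` / `hf`, the engine's level-one enclosure `hball0` [, `θ` / `hθ` in the `_of_congr` forms, `hs` on
the `5Nn` rows] — no table entry, no local datum, no rank datum.  What stays outside the kernel is unchanged: the ball `hball0` itself and
`Ω⁺_f = c_∞·ω₁` (inside `hϖ`).  X6-KURIHARA.md §24 / X7-KURIHARA.md §27.

HONEST FRAMING (run/shared/lean/b2b/bsd-rank1-residual/, verbatim in every file): the goal of the
cell is to DELETE the COMBINATION-SHAPED residual classes of the Birch–Swinnerton-Dyer formula for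
ALL analytic-rank `≤ 1` elliptic curves over `ℚ` — "full BSD formula for every rank `≤ 1` curve in
class `C`" assembled STRICTLY from published theorems — so that the rank-`≤ 1` remainder becomes
exactly the CONSTRUCTION-SHAPED classes, which are TYPED (missing-input `Prop`s), NOT attempted.
This is not "finishing BSD".  Classes X6 / X7 stay CONSTRUCTION-SHAPED (RESIDUAL-MAP §I N4 / N5); PER-PAIR OFFERS, nothing booked.

References: [Wuthrich2014] Prop. 21; [CremonaMazur2000] §3; [Fisher2016Visualizing7] Thm. 4.4; [Fisher2012Hessian] Thm. 13.2;
[SilvermanAEC2009] VII.3.1, Ex. 3.7; [Serre1973] II §3.3; [GreenbergVatsal2000] §3 Rem. 3.4; [Miller2011LMS] Def. 1.1; [Cremona2006] Table 1.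
-/

set_option autoImplicit false

noncomputable section

open scoped Classical MatrixGroups ModularForm

open CongruenceSubgroup WeierstrassCurve Literature.NumberTheory.EllipticCurves
  Literature.NumberTheory.EllipticCurves.Rank1Residual
  Literature.NumberTheory.EllipticCurves.Rank1Residual.Typed
  Literature.NumberTheory.EllipticCurves.Rank1Residual.X11RankOneCertificates
  Literature.NumberTheory.EllipticCurves.Wuthrich2014
  Literature.NumberTheory.EllipticCurves.Fisher2016
  Literature.NumberTheory.EllipticCurves.Fisher2012 Literature.NumberTheory.EllipticCurves.MazurRubin2015
  Summit.BirchSwinnertonDyer.BirchSwinnertonDyer.Rank1Residual.IntModel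
  Summit.BirchSwinnertonDyer.Rank1Residual.X11b
  Literature.NumberTheory.EllipticCurves.ModularForms
  Summit.BirchSwinnertonDyer.BirchSwinnertonDyer.Rank2Observatory.Tam
open NumberField IsDedekindDomain Rat.HeightOneSpectrum
open Summit.BirchSwinnertonDyer.Rank1Residual.Supersingular.LocalOddTorsion

namespace Summit.BirchSwinnertonDyer.Rank1Residual.Supersingular

/-- **`BSD(E,7)` for `422370du1`, OFFERED — EVERY LOCAL binder of the visibility offer DISCHARGED in the kernel.**  Exactly the landed layer-2 twin
(Cremona binders → `hball0` + kernel arithmetic; kind-(iii) binders PROVED) `bsdp_x7r0vis5bl_422370du1_7_of_congr`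
(`X7Visibility5L1CertLocRecords07.lean`) minus its 4 local torsion binder(s): `h2` (`#ker([7] : F(ℚ_w)) = 1` at `w = 2`) by
`natCard_ker_seven_partner_422370du1_at2 hFeq`; `h3` (`#ker([7] : F(ℚ_w)) = 1` at `w = 3`) by `natCard_ker_seven_partner_422370du1_at3 hFeq`; `h5`
(`#ker([7] : F(ℚ_w)) = 1` at `w = 5`) by `natCard_ker_seven_partner_422370du1_at5 hFeq`; `h19` (`#ker([7] : F(ℚ_w)) = 1` at `w = 19`) by
`natCard_ker_seven_partner_422370du1_at19 hFeq` — the record theorems of `X7VisibilityLocalTorsionRecords02.lean` (x10b gen 23/24: kernel decider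
`LocalOddTorsionDeciderAt` = Hensel root census of `ψ_7` over `ℤ_w` + square classes, bridge `LocalOddTorsionAdicCompletionAt`, certificates checked
by `decide +kernel`).  Proof = ONE term (the base twin applied to the record theorems).  BINDERS LEFT: the named facts `hCT` `hW` `hGZK` `hmod` `hϖ`
`hU` `hU2` `hF44` `hMR`; the models `hWeq` / `hFeq`; `f`, `hf`, `hball0`, `θ`, `hθ` — NO table entry, NO local datum, NO rank datum.  Per pair (an
OFFER for referee A); NOT a class theorem; nothing booked.
[cite: Wuthrich2014, Prop. 21 (p. 400)] [cite: CremonaMazur2000, §3 and Table 1] [cite: SilvermanAEC2009, VII.3.1 and Exercise 3.7]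
[cite: Cremona2006, Table 1 (Cremona label 422370du1)] -/
theorem bsdp_x7r0vis5blt_422370du1_7_of_congr
    (hCT : exists_casselsTate_pairing (K := ℚ)) (hW : sha_dvd_analyticSha)
    (hGZK : rank_eq_analyticRank_of_analyticRank_le_one) (hmod : hasEntireLFunction_rat)
    (hϖ : realPeriodRat_eq_unit_mul_plusPeriod)
    (hU : Silverman1994_thmV53_tateUniformisation.{0})
    (hU2 : Silverman1994_thmV53_corV54_tateUniformisation.{0})
    (hF44 : thm44_selmerLocalKer_iff_of_nonsplit_good) (hMR : selmerLocalKer_iff_of_goodReduction_above)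
    {W F : WeierstrassCurve ℚ} [W.IsElliptic] [W.IsGloballyMinimal] [F.IsElliptic] [F.IsGloballyMinimal]
    (hWeq : W = ⟨1, -1, 1, -1782219521048, -925402892231841253⟩) (hFeq : F = ⟨1, -1, 1, -68, 2207⟩)
    -- the engine's LEVEL-ONE ENCLOSURE of T₀ = L(E,1)/ω₁ (job j202394; replaces the Cremona data r_an = 0, #Ш_an of the source)
    {N : ℕ} [NeZero N] (f : CuspForm (Gamma0 N) 2) (hf : IsNewformOf W f)
    (hball0 : ∃ mid rad : ℝ, rad ≤ 1 / 10 ^ (20 : ℕ) ∧ |mid - ((1960 : ℤ) : ℝ)| ≤ 1 / 10 ^ (20 : ℕ) ∧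
      |((1 : ℕ) : ℝ) * (((1 : ℕ) : ℝ) * ((W.entireLFunction 1).re / plusPeriod f)) - mid| ≤ rad)
    (θ : geomTorsion F (7 : ℤ) ≃+ geomTorsion W (7 : ℤ))
    (hθ : ∀ (σ : Field.absoluteGaloisGroup ℚ) (P : geomTorsion F (7 : ℤ)), θ (σ • P) = σ • θ P) :
    BSDp W 7 := by
  -- natCard_ker_seven_partner_422370du1_at2 (X7VisibilityLocalTorsionRecords02.lean), proved in place
  have h2 :
    ∀ w : HeightOneSpectrum (𝓞 ℚ), (primesEquiv w : ℕ) = 2 →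
      Nat.card (nsmulAddMonoidHom 7 : (F.baseChange (w.adicCompletion ℚ)).toAffine.Point →+ _).ker = 1 := by
    intro w hw
    haveI : Fact (Nat.Prime 2) := ⟨by norm_num⟩
    refine natCard_ker_nsmul_seven_adicCompletion_eq_one_of_checkAt 2 1 (-1) 1 (-68) 2207 (by decide +kernel)
      (k := 2) (cert := []) (by decide +kernel) F ?_ hw
    rw [hFeq]; ext <;> norm_num
  -- natCard_ker_seven_partner_422370du1_at3 (X7VisibilityLocalTorsionRecords02.lean), proved in place
  have h3 :
    ∀ w : HeightOneSpectrum (𝓞 ℚ), (primesEquiv w : ℕ) = 3 →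
      Nat.card (nsmulAddMonoidHom 7 : (F.baseChange (w.adicCompletion ℚ)).toAffine.Point →+ _).ker = 1 := by
    intro w hw
    haveI : Fact (Nat.Prime 3) := ⟨by norm_num⟩
    refine natCard_ker_nsmul_seven_adicCompletion_eq_one_of_checkAt 3 1 (-1) 1 (-68) 2207 (by decide +kernel)
      (k := 2) (cert := []) (by decide +kernel) F ?_ hw
    rw [hFeq]; ext <;> norm_num
  -- natCard_ker_seven_partner_422370du1_at5 (X7VisibilityLocalTorsionRecords02.lean), proved in place
  have h5 :
    ∀ w : HeightOneSpectrum (𝓞 ℚ), (primesEquiv w : ℕ) = 5 →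
      Nat.card (nsmulAddMonoidHom 7 : (F.baseChange (w.adicCompletion ℚ)).toAffine.Point →+ _).ker = 1 := by
    intro w hw
    haveI : Fact (Nat.Prime 5) := ⟨by norm_num⟩
    refine natCard_ker_nsmul_seven_adicCompletion_eq_one_of_checkAt 5 1 (-1) 1 (-68) 2207 (by decide +kernel)
      (k := 1) (cert := []) (by decide +kernel) F ?_ hw
    rw [hFeq]; ext <;> norm_num
  -- natCard_ker_seven_partner_422370du1_at19 (X7VisibilityLocalTorsionRecords02.lean), proved in place
  have h19 :
    ∀ w : HeightOneSpectrum (𝓞 ℚ), (primesEquiv w : ℕ) = 19 →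
      Nat.card (nsmulAddMonoidHom 7 : (F.baseChange (w.adicCompletion ℚ)).toAffine.Point →+ _).ker = 1 := by
    intro w hw
    haveI : Fact (Nat.Prime 19) := ⟨by norm_num⟩
    refine natCard_ker_nsmul_seven_adicCompletion_eq_one_of_checkAt 19 1 (-1) 1 (-68) 2207 (by decide +kernel)
      (k := 1) (cert := []) (by decide +kernel) F ?_ hw
    rw [hFeq]; ext <;> norm_num
  exact bsdp_x7r0vis5bl_422370du1_7_of_congr hCT hW hGZK hmod hϖ hU hU2 hF44 hMR hWeq hFeq f hf hball0 θ hθ h2 h3 h5 h19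

end Summit.BirchSwinnertonDyer.Rank1Residual.Supersingular

end
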